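import Literature.IUT.HodgeTheaters.FPrimeStripsRigidity
import HarnessLib

/-!
# [IUTchI] Corollary 5.6 (i) — SUB-DAG: the printed proof (p. 154 l. 8–24) cut into intermediate statements over the prime-strip kit

S. Mochizuki, *Inter-universal Teichmüller theory I: construction of Hodge theaters*, kurims manuscript
(May 2020), §5, Corollary 5.6 (i), statement p. 153 l. 67–70, proof p. 154 l. 8–24
([IUTchI] Cor 5.6 (i) p.153) [claim: Mochizuki2012, status: disputed].  D-0068 (1) sub-DAG file
(plan/L5/SUBDAG-IUTchI-Cor56i.md, rows C56i/L01–L06); abc-iut cell, layer L5, seat abc-iut-w5-d217 under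
abc-iut-L5-lead's re-point of 2026-08-26.  STATEMENTS-FIRST: the intermediate statements are named `Prop`s over
abc-iut-L5-t4's Frobenioid-level kit `PMBaseKit.FKit` (`FPrimeStrips.lean`: Θ-Hodge theaters `ThetaHT`
([IUTchI] Def 3.6), their isomorphisms `ThetaHT.Iso` (Rmk 3.6.2), "the `ℱ`-prime-strip tautologically associated"
`ThetaHT.fStrip` (p. 147), the associated `𝒟`-prime-strip `ThetaHT.dStrip` (Rmk 5.2.1 (i)) and "the natural
functorially induced map" `ThetaHT.isoToD` of Cor 5.6 (i)); NOTHING of the series is asserted — the only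
`theorem`s are the formal implications between the rows, i.e. the ASSEMBLY of the printed proof, and kit-level
plumbing.  No new Literature FACT: every row is an [IUTchI]-internal statement INSIDE the Cor 3.12 cone, to be
PROVED at the real kit (TODO-merge:abc-iut-L5-t2 Examples 3.2–3.5 / abc-iut-L5-t4), never assumed by name in the cone.

Printed proof (p. 154 l. 8–24, verbatim from the kurims render, ligatures normalised): "Sorting through the data
listed in the definition of a Θ-Hodge theater `†ℋ𝒯^Θ` [cf. Definition 3.6], one verifies immediately that the only
data that is not contained in the associated `ℱ`-prime-strip `†𝔉_>` [cf. the discussion preceding Example 5.4] is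
the global data of Definition 3.6, (c), and the tempered Frobenioids isomorphic to "`ℱ̲_v`" [cf. Example 3.2, (i)]
at the `v ∈ 𝕍^bad`.  That is to say, for `v ∈ 𝕍^good`, one verifies immediately that `†ℱ_{>,v} = †ℱ̲_v` [cf.
Example 3.3, (i); Example 3.4, (i); Definition 3.6; Definition 5.2, (i)].  On the other hand, one verifies
immediately that this global data may be obtained by applying the functorial algorithm "`‡𝔉 ↦ ‡𝔉^⊩`" summarized in
the second display of Remark 5.2.1, (ii), to the associated `ℱ`-prime-strips that appear.  Thus, assertion (i)
follows by applying Corollary 5.3, (ii), to the associated `ℱ`-prime-strips and Corollary 5.3, (iv), to the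
various tempered Frobenioids at `v ∈ 𝕍^bad`."

THE CUT (rows of plan/L5/SUBDAG-IUTchI-Cor56i.md; `FK` a kit): C56i/L01 `ThetaHT.isoToD_eq_assocDMap_isoToF`
(the natural map FACTORS through `Isom(†𝔉_>, ‡𝔉_>)`; definitional, PROVED) · C56i/L02 `ThToFBijOnGood` ("for
`v ∈ 𝕍^good` … `†ℱ_{>,v} = †ℱ̲_v`") · C56i/L03 `RlfDetermined` (the global data extends UNIQUELY along the local data;
finer cut `RlfIsoFaithful` = "rigidity of the divisor monoids", Rmk 5.2.1 (ii), + `RlfIsoLifts` = functoriality of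
`‡𝔉 ↦ ‡𝔉^⊩`; `rlfDetermined_of`) · C56i/L04 = Cor 5.3 (ii) BY NAME `FKit.IsomFtoDBijective` · C56i/L05 = Cor 5.3 (iv) BY
NAME `FKit.AutTemperedBijective` (⇒ `thToF_mapIso_bijective_model_of_bad`, PROVED) · C56i/L06 `Cor56iKit` with the
ASSEMBLY `cor56iKit_of : L02 → L04 → L05 → L03 → Cor56iKit` (PROVED) and the TIGHTNESS `cor56iKit_iff_rlfDetermined`
(given L02/L04/L05, Cor 5.6 (i) ⟺ L03: L03 is exactly the residual content of the printed "one verifies immediately").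

Relation to the node's typed statement: abc-iut-L5-t3's `BaseThetaDatum.S5Local.Cor56i S` (`ThetaNFHodgeTheaters.lean`,
FROZEN G22) is the same sentence over the stub `S5Local` (OPAQUE groupoid `S.ThetaHT`, `S.assocStripIso`); its
conditional discharge `cor56i_of_rigid (hHT) (hbase)` (`ThetaNFHodgeTheatersProofs2.lean`) takes as `hHT` exactly what
rows L02+L03+L05 prove here for the kit's STRUCTURED Θ-Hodge theaters (`isoToF_bijective_of_rows`) and as `hbase`
row L04 constituent-wise.  CONSISTENCY: every row holds for the toy kit `FKit.toy` (section `Witness`).  Typed ≠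
proved for the real kit; no side is taken on [IUTchIII] Cor 3.12.
-/

namespace Literature.IUT.HodgeTheaters

open CategoryTheory

universe u

namespace PMBaseKit

namespace FKit

noncomputable section

variable {l : ℕ} {K : PMBaseKit.{u} l} {M : K.MultKit} {FK : K.FKit M}

/-! ### Kit-level plumbing (Mathlib folklore) -/

/-- Conjugation transport for an arbitrary functor `G`: if `G` is bijective on the automorphisms of an object `A`,
it is bijective on the isomorphisms between any two isomorphs `X ≅ A`, `Y ≅ A` (the passage "from the model to its
isomorphs" used throughout [IUTchI] §5; cf. `FKit.mapIso_bijective_of_model` for `G = toD v`). [folklore] -/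
private theorem mapIso_bijective_conj {C : Type*} [Category C] {E : Type*} [Category E] (G : C ⥤ E) {A X Y : C}
    (h : Function.Bijective fun α : A ≅ A => G.mapIso α) (eX : X ≅ A) (eY : Y ≅ A) :
    Function.Bijective fun φ : X ≅ Y => G.mapIso φ := by
  have key : ∀ φ : X ≅ Y, eX ≪≫ (eX.symm ≪≫ φ ≪≫ eY) ≪≫ eY.symm = φ := fun φ => by ext; simp
  constructor
  · intro φ₁ φ₂ hφ
    have h' : G.mapIso (eX.symm ≪≫ φ₁ ≪≫ eY) = G.mapIso (eX.symm ≪≫ φ₂ ≪≫ eY) := by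
      have hφ' : G.mapIso φ₁ = G.mapIso φ₂ := hφ
      simp only [Functor.mapIso_trans, hφ']
    have h2 := h.1 h'
    rw [← key φ₁, ← key φ₂]
    exact congrArg (fun β => eX ≪≫ β ≪≫ eY.symm) h2
  · intro ψ
    obtain ⟨α, hα⟩ := h.2 ((G.mapIso eX).symm ≪≫ ψ ≪≫ G.mapIso eY)
    refine ⟨eX ≪≫ α ≪≫ eY.symm, ?_⟩
    have hα' : G.mapIso α = (G.mapIso eX).symm ≪≫ ψ ≪≫ G.mapIso eY := hα
    show G.mapIso (eX ≪≫ α ≪≫ eY.symm) = ψ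
    simp only [Functor.mapIso_trans, Functor.mapIso_symm, hα']
    ext; simp

/-- If `g ∘ f` is bijective and `g` is injective then `f` is bijective. [folklore] -/
private theorem bijective_of_bijective_comp_of_injective {α β γ : Sort*} {f : α → β} {g : β → γ}
    (hgf : Function.Bijective (g ∘ f)) (hg : Function.Injective g) : Function.Bijective f :=
  ⟨hgf.1.of_comp, fun y => by obtain ⟨x, hx⟩ := hgf.2 (g y); exact ⟨x, hg hx⟩⟩

/-- A family of bijections is a bijection of families ("a morphism of prime-strips is a collection of
isomorphisms indexed by `𝕍`", [IUTchI] Def 5.2 (iii) p. 134). [folklore] -/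
private theorem pi_map_bijective {ι : Sort*} {α β : ι → Sort*} (f : ∀ i, α i → β i)
    (hf : ∀ i, Function.Bijective (f i)) :
    Function.Bijective fun (a : ∀ i, α i) (i : ι) => f i (a i) := by
  refine ⟨fun a b h => funext fun i => (hf i).1 (congrFun h i), fun b => ?_⟩
  choose a ha using fun i => (hf i).2 (b i); exact ⟨a, funext ha⟩

/-- Two isomorphisms of Θ-Hodge theaters with the same local and global components are equal (the compatibility
`compat` of [IUTchI] Rmk 3.6.2 is a proposition). ([IUTchI] Def 3.6 p.87) [claim: Mochizuki2012, status: disputed] -/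
theorem ThetaHT.Iso.ext_of_thIso_rlfIso {H₁ H₂ : FK.ThetaHT} {φ ψ : ThetaHT.Iso H₁ H₂}
    (h₁ : φ.thIso = ψ.thIso) (h₂ : φ.rlfIso = ψ.rlfIso) : φ = ψ := by
  cases φ; cases ψ; cases h₁; cases h₂; rfl

/-! ### C56i/L06 (target): Corollary 5.6 (i) in kit vocabulary -/

variable (FK) in
/-- **C56i/L06 — [IUTchI] Cor 5.6 (i) over the kit** (statement p. 153 l. 67–70): "The natural functorially induced
map from the set of isomorphisms between two Θ-Hodge theaters to the set of isomorphisms between the respective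
associated `𝒟`-prime-strips [cf. the discussion preceding Example 5.4; Remark 5.2.1, (i)] is bijective" — for the
STRUCTURED Θ-Hodge theaters `FK.ThetaHT` of abc-iut-L5-t4's kit and their "natural functorially induced map"
`ThetaHT.isoToD`.  (The node's frozen statement `BaseThetaDatum.S5Local.Cor56i` is the same sentence over the
opaque groupoid of the stub `S5Local`; see the module docstring.)  Named statement, NOT asserted; its derivation
from rows L02–L05 is `cor56iKit_of`. ([IUTchI] Cor 5.6 (i) p.153) [claim: Mochizuki2012, status: disputed] -/
def Cor56iKit : Prop :=
  ∀ H₁ H₂ : FK.ThetaHT, Function.Bijective (ThetaHT.isoToD : ThetaHT.Iso H₁ H₂ → H₁.dStrip.Iso H₂.dStrip)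

/-! ### C56i/L01: the natural map factors through the associated `ℱ`-prime-strips (p. 154 l. 8–13) -/

/-- **C56i/L01, data**: the isomorphism `†𝔉_> ⥲ ‡𝔉_>` of associated `ℱ`-prime-strips induced by an isomorphism of
Θ-Hodge theaters — componentwise `thToF v` on the local isomorphisms ("the `ℱ`-prime-strip tautologically associated
to this Θ-Hodge theater [cf. the data `{†ℱ̲_v}_{v∈𝕍}` of Definition 3.6 …]", p. 147). ([IUTchI] Ex 5.4 p.147) [claim: Mochizuki2012, status: disputed] -/
def ThetaHT.isoToF {H₁ H₂ : FK.ThetaHT} (φ : ThetaHT.Iso H₁ H₂) : H₁.fStrip.Iso H₂.fStrip :=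
  fun v => (FK.thToF v).mapIso (φ.thIso v)

/-- The same map on bare families of local isomorphisms `{†ℱ̲_v ⥲ ‡ℱ̲_v}_{v∈𝕍}` (no global component).
([IUTchI] Ex 5.4 p.147) [claim: Mochizuki2012, status: disputed] -/
def ThetaHT.thIsoToF (H₁ H₂ : FK.ThetaHT) (t : ∀ v, H₁.th v ≅ H₂.th v) : H₁.fStrip.Iso H₂.fStrip :=
  fun v => (FK.thToF v).mapIso (t v)

/-- **C56i/L01** (p. 154 l. 8–13, "the only data that is not contained in the associated `ℱ`-prime-strip `†𝔉_>` …"):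
the natural map `Isom(†ℋ𝒯^Θ, ‡ℋ𝒯^Θ) → Isom(†𝔇_>, ‡𝔇_>)` of Cor 5.6 (i) is the composite of
`Isom(†ℋ𝒯^Θ, ‡ℋ𝒯^Θ) → Isom(†𝔉_>, ‡𝔉_>)` with the natural map `Isom(†𝔉_>, ‡𝔉_>) → Isom(†𝔇_>, ‡𝔇_>)` of Cor 5.3 (ii)
(Rmk 5.2.1 (i)) — PROVED (definitional). ([IUTchI] Cor 5.6 (i) p.154) [claim: Mochizuki2012, status: disputed] -/
theorem ThetaHT.isoToD_eq_assocDMap_isoToF {H₁ H₂ : FK.ThetaHT} (φ : ThetaHT.Iso H₁ H₂) :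
    ThetaHT.isoToD φ = FStrip.assocDMap (ThetaHT.isoToF φ) := by
  funext v; exact Iso.ext rfl

/-- C56i/L01, equivalently: `isoToD φ = assocDMap (thIsoToF φ.thIso)` — the natural map only sees the LOCAL components
of an isomorphism of Θ-Hodge theaters. ([IUTchI] Cor 5.6 (i) p.154) [claim: Mochizuki2012, status: disputed] -/
theorem ThetaHT.isoToD_eq_assocDMap_thIsoToF {H₁ H₂ : FK.ThetaHT} (φ : ThetaHT.Iso H₁ H₂) :
    ThetaHT.isoToD φ = FStrip.assocDMap (ThetaHT.thIsoToF H₁ H₂ φ.thIso) := by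
  funext v; exact Iso.ext rfl

/-! ### C56i/L02: "for `v ∈ 𝕍^good`, one verifies immediately that `†ℱ_{>,v} = †ℱ̲_v`" (p. 154 l. 13–16) -/

variable (FK) in
/-- **C56i/L02** (p. 154 l. 13–16): "for `v ∈ 𝕍^good`, one verifies immediately that `†ℱ_{>,v} = †ℱ̲_v` [cf.
Example 3.3, (i); Example 3.4, (i); Definition 3.6; Definition 5.2, (i)]" — in kit vocabulary: at `v ∉ 𝕍^bad` the
functor `thToF v` that extracts the `ℱ`-prime-strip datum of Def 5.2 (i) from the local datum of Def 3.6 (a), (b)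
loses nothing, i.e. is bijective on isomorphisms (MODEL form, on `Aut(ℱ̲_v)`; the passage to arbitrary isomorphs is
the private conjugation lemma `mapIso_bijective_conj`).  In the intended model `thToF v` is the identity at good `v`.  Named statement, NOT
asserted. ([IUTchI] Cor 5.6 (i) p.154) [claim: Mochizuki2012, status: disputed] -/
def ThToFBijOnGood : Prop :=
  ∀ v, v ∉ K.bad → Function.Bijective fun α : FK.thModel v ≅ FK.thModel v => (FK.thToF v).mapIso α

/-! ### C56i/L04 = Cor 5.3 (ii) `IsomFtoDBijective`; C56i/L05 = Cor 5.3 (iv) `AutTemperedBijective` (p. 154 l. 20–23)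

Both inputs are CONSUMED BY NAME from `FPrimeStrips.lean` (nodes IUTchI:Cor5.3(ii), IUTchI:Cor5.3(iv)); no statement
is re-typed here.  What the printed proof needs from them at `v ∈ 𝕍^bad` is the bijectivity of `thToF v` on
isomorphisms of tempered Frobenioids, which we DERIVE: `Aut(ℱ̲_v) → Aut(ℱ_{>,v}) → Aut(𝒟_v)` is bijective by
Cor 5.3 (iv) and its second arrow is injective by Cor 5.3 (ii). -/

/-- **C56i/L05 ⇒ local bijectivity at bad `v`** (p. 154 l. 22–23, "Corollary 5.3, (iv), [applied] to the various
tempered Frobenioids at `v ∈ 𝕍^bad`"): from Cor 5.3 (iv) (`AutTemperedBijective`: `Aut(ℱ̲_v) → Aut(𝒟_v)` bijective) and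
Cor 5.3 (ii) (`IsomFtoDBijective`, whose model case makes `Aut(ℱ_v) → Aut(𝒟_v)` injective), the functor `thToF v` is
bijective on `Aut(ℱ̲_v)` for `v ∈ 𝕍^bad`.  PROVED from the two named inputs.
([IUTchI] Cor 5.6 (i) p.154) [claim: Mochizuki2012, status: disputed] -/
theorem thToF_mapIso_bijective_model_of_bad (h53ii : FK.IsomFtoDBijective) (h53iv : FK.AutTemperedBijective)
    (v : K.V) (hv : v ∈ K.bad) :
    Function.Bijective fun α : FK.thModel v ≅ FK.thModel v => (FK.thToF v).mapIso α := by
  have hD : Function.Bijective fun φ : (FK.thToF v).obj (FK.thModel v) ≅ (FK.thToF v).obj (FK.thModel v) =>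
      (FK.toD v).mapIso φ :=
    mapIso_bijective_of_model v (model_bijective_of_isomFtoDBijective h53ii v) (FK.thToF_model v)
      (FK.thToF_model v)
  have hcomp : (fun α : Aut (FK.thModel v) => (FK.thToF v ⋙ FK.toD v).mapIso α) =
      (fun φ : (FK.thToF v).obj (FK.thModel v) ≅ (FK.thToF v).obj (FK.thModel v) => (FK.toD v).mapIso φ) ∘
        (fun α : FK.thModel v ≅ FK.thModel v => (FK.thToF v).mapIso α) := funext fun α => Iso.ext rfl
  have h := h53iv v hv
  rw [hcomp] at h
  exact bijective_of_bijective_comp_of_injective h hD.1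

/-- **Local bijectivity at every `v`** (rows L02 at `v ∈ 𝕍^good`, L04+L05 at `v ∈ 𝕍^bad`), transported from the
models to the local data of two arbitrary Θ-Hodge theaters: `thToF v : Isom(†ℱ̲_v, ‡ℱ̲_v) → Isom(†ℱ_{>,v}, ‡ℱ_{>,v})` is
bijective.  PROVED from the named rows. ([IUTchI] Cor 5.6 (i) p.154) [claim: Mochizuki2012, status: disputed] -/
theorem thToF_mapIso_bijective_of_rows (h02 : FK.ThToFBijOnGood) (h53ii : FK.IsomFtoDBijective)
    (h53iv : FK.AutTemperedBijective) (H₁ H₂ : FK.ThetaHT) (v : K.V) :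
    Function.Bijective fun t : H₁.th v ≅ H₂.th v => (FK.thToF v).mapIso t := by
  have hmodel : Function.Bijective fun α : FK.thModel v ≅ FK.thModel v => (FK.thToF v).mapIso α := by
    by_cases hv : v ∈ K.bad
    · exact thToF_mapIso_bijective_model_of_bad h53ii h53iv v hv
    · exact h02 v hv
  exact mapIso_bijective_conj (FK.thToF v) hmodel (H₁.th_isModel v).some (H₂.th_isModel v).some

/-- Hence families of local isomorphisms `{†ℱ̲_v ⥲ ‡ℱ̲_v}_v` correspond bijectively to isomorphisms of the associated
`ℱ`-prime-strips `†𝔉_> ⥲ ‡𝔉_>` (rows L02, L04, L05). PROVED. ([IUTchI] Cor 5.6 (i) p.154) [claim: Mochizuki2012, status: disputed] -/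
theorem thIsoToF_bijective_of_rows (h02 : FK.ThToFBijOnGood) (h53ii : FK.IsomFtoDBijective)
    (h53iv : FK.AutTemperedBijective) (H₁ H₂ : FK.ThetaHT) :
    Function.Bijective (ThetaHT.thIsoToF H₁ H₂) :=
  pi_map_bijective (fun v (t : H₁.th v ≅ H₂.th v) => (FK.thToF v).mapIso t)
    (thToF_mapIso_bijective_of_rows h02 h53ii h53iv H₁ H₂)

/-! ### C56i/L03: the global data is "obtained by applying the functorial algorithm `‡𝔉 ↦ ‡𝔉^⊩`" (p. 154 l. 16–20) -/

/-- The compatibility square of [IUTchI] Rmk 3.6.2 / Def 3.6 (c) (= the field `ThetaHT.Iso.compat` of abc-iut-L5-t4)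
between a family `t` of local isomorphisms and an isomorphism `r` of the global realified data, through the
identifications `rlf_fm : (‡𝔉^⊩_mod)^⊢_v ≅ (‡ℱ̲_v)^⊢` ("`†ℱ^⊢_v` is as discussed in (a), (b) above", Def 3.6 (c) p. 87).
([IUTchI] Def 3.6 p.87) [claim: Mochizuki2012, status: disputed] -/
def ThetaHT.RlfCompat (H₁ H₂ : FK.ThetaHT) (t : ∀ v, H₁.th v ≅ H₂.th v) (r : H₁.rlf ≅ H₂.rlf) : Prop :=
  ∀ v, (FK.rlfFm v).map r.hom ≫ (H₂.rlf_fm v).hom =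
    (H₁.rlf_fm v).hom ≫ (FK.toFm v).map ((FK.thToF v).map (t v).hom)

/-- An isomorphism of Θ-Hodge theaters satisfies the compatibility square with its own components (this IS the
field `compat`). ([IUTchI] Def 3.6 p.87) [claim: Mochizuki2012, status: disputed] -/
theorem ThetaHT.Iso.rlfCompat {H₁ H₂ : FK.ThetaHT} (φ : ThetaHT.Iso H₁ H₂) :
    ThetaHT.RlfCompat H₁ H₂ φ.thIso φ.rlfIso :=
  φ.compat

/-- Under the compatibility square the `ℱ^⊢`-components of `r` are PINNED by `t`:
`(rlfFm v)(r) = rlf_fm₁ ≫ (toFm v)(thToF v)(t v) ≫ rlf_fm₂⁻¹`. ([IUTchI] Def 3.6 p.87) [claim: Mochizuki2012, status: disputed] -/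
theorem ThetaHT.RlfCompat.map_rlfFm_eq {H₁ H₂ : FK.ThetaHT} {t : ∀ v, H₁.th v ≅ H₂.th v} {r : H₁.rlf ≅ H₂.rlf}
    (h : ThetaHT.RlfCompat H₁ H₂ t r) (v : K.V) :
    (FK.rlfFm v).map r.hom =
      ((H₁.rlf_fm v).hom ≫ (FK.toFm v).map ((FK.thToF v).map (t v).hom)) ≫ (H₂.rlf_fm v).inv :=
  (Iso.eq_comp_inv _).mpr (h v)

variable (FK) in
/-- **C56i/L03a — `ℱ^⊩` is rigid over `ℱ^⊢`** ([IUTchI] Rmk 5.2.1 (ii) p. 143 l. 19–34: "it follows immediately [cf.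
Definition 5.2, (i)] from the rigidity of the divisor monoids associated to the Frobenioids that appear at each of
the components at `v ∈ 𝕍` of an `ℱ`-prime-strip [cf., especially, the topological field structure of the field
"`A_{𝒟_v}`" of Example 3.4, (i)!] that one may also construct from the `ℱ`-prime-strip `‡𝔉`, via a functorial
algorithm …, a collection of data `‡𝔉 ↦ ‡𝔉^⊩`"): an isomorphism between the global realified data `†𝔉^⊩_mod`,
`‡𝔉^⊩_mod` of two Θ-Hodge theaters is DETERMINED by its `ℱ^⊢`-prime-strip components.  Real-model evidence at the
divisor-monoid level: `InitialThetaData.phiMod_addEquiv_eq_refl_of_rho_compat` (`GlobalRealifiedFrobenioidsRigidity.lean`,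
abc-iut-w4-d009).  Named statement, NOT asserted. ([IUTchI] Rmk 5.2.1 (ii) p.143) [claim: Mochizuki2012, status: disputed] -/
def RlfIsoFaithful : Prop :=
  ∀ (H₁ H₂ : FK.ThetaHT) (a b : H₁.rlf ≅ H₂.rlf),
    (∀ v, (FK.rlfFm v).map a.hom = (FK.rlfFm v).map b.hom) → a = b

variable (FK) in
/-- **C56i/L03b — the global data extends along the local data** (p. 154 l. 16–20: "one verifies immediately that
this global data may be obtained by applying the functorial algorithm "`‡𝔉 ↦ ‡𝔉^⊩`" summarized in the second display
of Remark 5.2.1, (ii), to the associated `ℱ`-prime-strips that appear"): every family of isomorphisms of the local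
data of two Θ-Hodge theaters admits a global component satisfying the compatibility square of Rmk 3.6.2 (the
functoriality `FKit.rlfOfMap` of `‡𝔉 ↦ ‡𝔉^⊩`, transported through the identification of `†𝔉^⊩_mod` with `(†𝔉_>)^⊩`).
Named statement, NOT asserted. ([IUTchI] Cor 5.6 (i) p.154) [claim: Mochizuki2012, status: disputed] -/
def RlfIsoLifts : Prop :=
  ∀ (H₁ H₂ : FK.ThetaHT) (t : ∀ v, H₁.th v ≅ H₂.th v), ∃ r : H₁.rlf ≅ H₂.rlf, ThetaHT.RlfCompat H₁ H₂ t r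

variable (FK) in
/-- **C56i/L03 — the row of record** (p. 154 l. 8–20, "the only data that is not contained in the associated
`ℱ`-prime-strip `†𝔉_>` … is the global data of Definition 3.6, (c) [which] may be obtained by applying the
functorial algorithm "`‡𝔉 ↦ ‡𝔉^⊩`" … to the associated `ℱ`-prime-strips"): the global realified datum of a Θ-Hodge
theater carries NO isomorphism data beyond the local data — every family of local isomorphisms extends UNIQUELY,
compatibly with Def 3.6 (c), to the global data.  Named statement, NOT asserted; = `RlfIsoFaithful ∧ RlfIsoLifts` up to
`rlfDetermined_of`, and NECESSARY for Cor 5.6 (i) by `rlfDetermined_of_cor56iKit`.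
([IUTchI] Cor 5.6 (i) p.154) [claim: Mochizuki2012, status: disputed] -/
def RlfDetermined : Prop :=
  ∀ (H₁ H₂ : FK.ThetaHT) (t : ∀ v, H₁.th v ≅ H₂.th v), ∃! r : H₁.rlf ≅ H₂.rlf, ThetaHT.RlfCompat H₁ H₂ t r

/-- **L03a ∧ L03b ⇒ L03**: rigidity gives uniqueness (the compatibility square pins the `ℱ^⊢`-components,
`ThetaHT.RlfCompat.map_rlfFm_eq`), lifting gives existence. PROVED. ([IUTchI] Cor 5.6 (i) p.154) [claim: Mochizuki2012, status: disputed] -/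
theorem rlfDetermined_of (ha : FK.RlfIsoFaithful) (hb : FK.RlfIsoLifts) : FK.RlfDetermined := by
  intro H₁ H₂ t
  obtain ⟨r, hr⟩ := hb H₁ H₂ t
  refine ⟨r, hr, fun r' hr' => ha H₁ H₂ r' r fun v => ?_⟩
  rw [hr'.map_rlfFm_eq v, hr.map_rlfFm_eq v]

/-- **L03 ⇒ the local components determine an isomorphism of Θ-Hodge theaters**: `φ ↦ φ.thIso` is a bijection
`Isom(†ℋ𝒯^Θ, ‡ℋ𝒯^Θ) ⥲ ∏_v Isom(†ℱ̲_v, ‡ℱ̲_v)` ("sorting through the data listed in the definition of a Θ-Hodge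
theater", p. 154 l. 8–9). PROVED from row L03. ([IUTchI] Cor 5.6 (i) p.154) [claim: Mochizuki2012, status: disputed] -/
theorem thIso_bijective_of_rlfDetermined (h03 : FK.RlfDetermined) (H₁ H₂ : FK.ThetaHT) :
    Function.Bijective fun φ : ThetaHT.Iso H₁ H₂ => φ.thIso := by
  constructor
  · intro φ ψ h
    obtain ⟨r, -, huniq⟩ := h03 H₁ H₂ ψ.thIso
    have hc := φ.rlfCompat
    rw [show φ.thIso = ψ.thIso from h] at hc
    exact ThetaHT.Iso.ext_of_thIso_rlfIso h ((huniq _ hc).trans (huniq _ ψ.rlfCompat).symm)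
  · intro t
    obtain ⟨r, hr, -⟩ := h03 H₁ H₂ t
    exact ⟨⟨t, r, hr⟩, rfl⟩

/-! ### C56i/L06: assembly of the printed proof, and tightness of row L03 -/

/-- **The `hHT` input of abc-iut-L5-t3's `cor56i_of_rigid`, from the rows**: isomorphisms of Θ-Hodge theaters
correspond bijectively, via `ThetaHT.isoToF`, to isomorphisms of the associated `ℱ`-prime-strips (p. 154 l. 8–20:
everything outside `†𝔉_>` is either recovered functorially (global data, L03) or rigid over it (tempered Frobenioids
at bad `v`, L05; nothing at good `v`, L02)). PROVED from the named rows.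
([IUTchI] Cor 5.6 (i) p.154) [claim: Mochizuki2012, status: disputed] -/
theorem isoToF_bijective_of_rows (h02 : FK.ThToFBijOnGood) (h53ii : FK.IsomFtoDBijective)
    (h53iv : FK.AutTemperedBijective) (h03 : FK.RlfDetermined) (H₁ H₂ : FK.ThetaHT) :
    Function.Bijective (ThetaHT.isoToF : ThetaHT.Iso H₁ H₂ → H₁.fStrip.Iso H₂.fStrip) := by
  have hfac : (ThetaHT.isoToF : ThetaHT.Iso H₁ H₂ → H₁.fStrip.Iso H₂.fStrip) =
      ThetaHT.thIsoToF H₁ H₂ ∘ fun φ : ThetaHT.Iso H₁ H₂ => φ.thIso := rfl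
  rw [hfac]
  exact (thIsoToF_bijective_of_rows h02 h53ii h53iv H₁ H₂).comp (thIso_bijective_of_rlfDetermined h03 H₁ H₂)

/-- **C56i/L06 — ASSEMBLY of the printed proof of [IUTchI] Cor 5.6 (i)** (p. 154 l. 8–24): "Thus, assertion (i)
follows by applying Corollary 5.3, (ii), to the associated `ℱ`-prime-strips [row L04] and Corollary 5.3, (iv), to
the various tempered Frobenioids at `v ∈ 𝕍^bad` [row L05]" — after the sorting of rows L01 (factorisation), L02
(good `v`) and L03 (global data).  PROVED: `Cor56iKit` follows from the four named rows; the only inputs that are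
not nodes of their own (Cor 5.3 (ii), (iv)) are L02 and L03.  CONDITIONAL on the rows; typed ≠ proved for the real
kit. ([IUTchI] Cor 5.6 (i) p.154) [claim: Mochizuki2012, status: disputed] -/
theorem cor56iKit_of (h02 : FK.ThToFBijOnGood) (h53ii : FK.IsomFtoDBijective)
    (h53iv : FK.AutTemperedBijective) (h03 : FK.RlfDetermined) : FK.Cor56iKit := by
  intro H₁ H₂
  have hfac : (ThetaHT.isoToD : ThetaHT.Iso H₁ H₂ → H₁.dStrip.Iso H₂.dStrip) =
      FStrip.assocDMap ∘ (ThetaHT.isoToF : ThetaHT.Iso H₁ H₂ → H₁.fStrip.Iso H₂.fStrip) :=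
    funext ThetaHT.isoToD_eq_assocDMap_isoToF
  rw [hfac]
  exact (h53ii H₁.fStrip H₂.fStrip).comp (isoToF_bijective_of_rows h02 h53ii h53iv h03 H₁ H₂)

/-- **Tightness of row L03, uniqueness half**: if the natural map of Cor 5.6 (i) is merely INJECTIVE, then the global
component of an isomorphism of Θ-Hodge theaters is determined by the local components (no other row needed: the
natural map does not see the global component, row L01). PROVED. ([IUTchI] Cor 5.6 (i) p.154) [claim: Mochizuki2012, status: disputed] -/
theorem rlfIso_unique_of_isoToD_injective {H₁ H₂ : FK.ThetaHT}
    (hinj : Function.Injective (ThetaHT.isoToD : ThetaHT.Iso H₁ H₂ → H₁.dStrip.Iso H₂.dStrip))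
    (t : ∀ v, H₁.th v ≅ H₂.th v) {r r' : H₁.rlf ≅ H₂.rlf}
    (hr : ThetaHT.RlfCompat H₁ H₂ t r) (hr' : ThetaHT.RlfCompat H₁ H₂ t r') : r = r' := by
  have h : ThetaHT.isoToD (⟨t, r, hr⟩ : ThetaHT.Iso H₁ H₂) = ThetaHT.isoToD (⟨t, r', hr'⟩ : ThetaHT.Iso H₁ H₂) := by
    rw [ThetaHT.isoToD_eq_assocDMap_thIsoToF, ThetaHT.isoToD_eq_assocDMap_thIsoToF]
  exact congrArg ThetaHT.Iso.rlfIso (hinj h)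

/-- **Tightness of row L03**: conversely, GIVEN rows L02, L04, L05, Cor 5.6 (i) over the kit IMPLIES row L03 — so L03
is exactly the residual content of the printed "one verifies immediately that this global data may be obtained by
applying the functorial algorithm `‡𝔉 ↦ ‡𝔉^⊩`".  PROVED. ([IUTchI] Cor 5.6 (i) p.154) [claim: Mochizuki2012, status: disputed] -/
theorem rlfDetermined_of_cor56iKit (h : FK.Cor56iKit) (h02 : FK.ThToFBijOnGood)
    (h53ii : FK.IsomFtoDBijective) (h53iv : FK.AutTemperedBijective) : FK.RlfDetermined := by
  intro H₁ H₂ t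
  have hbij := h H₁ H₂
  -- existence: lift the `𝒟`-prime-strip isomorphism induced by `t` to an isomorphism of Θ-Hodge theaters
  obtain ⟨φ, hφ⟩ := hbij.2 (FStrip.assocDMap (ThetaHT.thIsoToF H₁ H₂ t))
  have hF : ThetaHT.thIsoToF H₁ H₂ φ.thIso = ThetaHT.thIsoToF H₁ H₂ t := by
    apply (h53ii H₁.fStrip H₂.fStrip).1
    rw [← ThetaHT.isoToD_eq_assocDMap_thIsoToF, hφ]
  have ht : φ.thIso = t := (thIsoToF_bijective_of_rows h02 h53ii h53iv H₁ H₂).1 hF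
  refine ⟨φ.rlfIso, ?_, fun r' hr' => ?_⟩
  · have hc := φ.rlfCompat
    rw [ht] at hc
    exact hc
  · have hc := φ.rlfCompat
    rw [ht] at hc
    exact rlfIso_unique_of_isoToD_injective hbij.1 t hr' hc

/-- **The cut is exact**: over any kit satisfying rows L02, L04, L05 (good places transparent, Cor 5.3 (ii), (iv)),
Cor 5.6 (i) holds IF AND ONLY IF row L03 holds. PROVED. ([IUTchI] Cor 5.6 (i) p.154) [claim: Mochizuki2012, status: disputed] -/
theorem cor56iKit_iff_rlfDetermined (h02 : FK.ThToFBijOnGood) (h53ii : FK.IsomFtoDBijective)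
    (h53iv : FK.AutTemperedBijective) : FK.Cor56iKit ↔ FK.RlfDetermined :=
  ⟨fun h => rlfDetermined_of_cor56iKit h h02 h53ii h53iv, cor56iKit_of h02 h53ii h53iv⟩

end

end FKit

/-! ### Consistency: every row holds for the toy kit `FKit.toy` -/

section Witness

variable (l : ℕ) [Fact l.Prime] (hl : l ≠ 2)

/-- CONSISTENCY of row L02 as typed: in the toy kit `thToF v` is the identity. ([IUTchI] Cor 5.6 (i) p.154) [claim: Mochizuki2012, status: disputed] -/
theorem FKit.thToFBijOnGood_toy : (FKit.toy l hl).ThToFBijOnGood := by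
  intro v _
  exact ⟨fun α β h => Iso.ext (congrArg Iso.hom h), fun ψ => ⟨ψ, Iso.ext rfl⟩⟩

/-- CONSISTENCY of row L03a as typed: in the toy kit the global realified category is the product over `𝕍` with
`rlfFm v` the projections. ([IUTchI] Rmk 5.2.1 (ii) p.143) [claim: Mochizuki2012, status: disputed] -/
theorem FKit.rlfIsoFaithful_toy : (FKit.toy l hl).RlfIsoFaithful := by
  intro H₁ H₂ a b h
  exact Iso.ext (funext fun v => h v)

/-- CONSISTENCY of row L03b as typed: in the toy kit `v ↦ rlf_fm₁ ≫ t v ≫ rlf_fm₂⁻¹` is the lift. ([IUTchI] Cor 5.6 (i) p.154) [claim: Mochizuki2012, status: disputed] -/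
theorem FKit.rlfIsoLifts_toy : (FKit.toy l hl).RlfIsoLifts := by
  intro H₁ H₂ t
  refine ⟨Pi.isoMk fun v => H₁.rlf_fm v ≪≫ t v ≪≫ (H₂.rlf_fm v).symm, fun v => ?_⟩
  show (H₁.rlf_fm v ≪≫ t v ≪≫ (H₂.rlf_fm v).symm).hom ≫ (H₂.rlf_fm v).hom = (H₁.rlf_fm v).hom ≫ (t v).hom
  simp only [Iso.trans_hom, Iso.symm_hom, Category.assoc]
  erw [Iso.inv_hom_id, Category.comp_id]
  rfl

/-- CONSISTENCY of Cor 5.3 (iv) as typed for the toy kit (identity functors). ([IUTchI] Cor 5.3 (iv) p.144) [claim: Mochizuki2012, status: disputed] -/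
theorem FKit.autTemperedBijective_toy : (FKit.toy l hl).AutTemperedBijective := by
  intro v _
  exact ⟨fun α β h => Iso.ext (congrArg Iso.hom h), fun ψ => ⟨ψ, Iso.ext rfl⟩⟩

/-- CONSISTENCY of the assembled Cor 5.6 (i): `Cor56iKit` HOLDS for the toy kit, by `cor56iKit_of` from the four rows
(Cor 5.3 (ii) there is abc-iut-L5-d4's `isomFtoDBijective_toy`) — the rows are jointly satisfiable exactly as typed and
the assembly is not vacuous. ([IUTchI] Cor 5.6 (i) p.153) [claim: Mochizuki2012, status: disputed] -/
theorem FKit.cor56iKit_toy : (FKit.toy l hl).Cor56iKit :=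
  FKit.cor56iKit_of (FKit.thToFBijOnGood_toy l hl) (FKit.isomFtoDBijective_toy l hl)
    (FKit.autTemperedBijective_toy l hl)
    (FKit.rlfDetermined_of (FKit.rlfIsoFaithful_toy l hl) (FKit.rlfIsoLifts_toy l hl))

end Witness

end PMBaseKit

end Literature.IUT.HodgeTheaters
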